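import Literature.Geometry.GeometricMeasureTheory.HausdorffFinite
import Mathlib.MeasureTheory.Constructions.Polish.Basic
import Mathlib.Analysis.RCLike.Lemmas
import Mathlib.Order.Disjointed
import HarnessLib

/-!
# Finite Hausdorff measure from Lipschitz sections with bounded multiplicity (Lelong's theorem)

The measure-theoretic core of our proof of Lelong's theorem ([Chirka1989, §14.1 Thm.],
`Literature/Geometry/Kaehler/HolomorphicChainFacts.lean`), isolated from the analytic geometry.
In print: `vol_{2p}(reg A ∩ U) = Σ'_I ∫_{reg A ∩ U} dV_I ≤ Σ'_I k_I vol_{2p} U'_I` (Wirtinger's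
theorem and the sheet numbers `k_I` of the proper coordinate projections). Here: a bounded Borel
set `G` in a finite-dimensional complex normed space `E` has `𝓗^{2p}(G) < ∞` as soon as there are
finitely many continuous linear maps `ℓ_j : E → ℂᵖ` with

* **bounded multiplicity** — at most `Kb_j` points of `G` in each fibre of `ℓ_j`, and
* **local Lipschitz sections** — every point of `G` has an open neighbourhood `W` on which, for
  some `j`, `G ∩ W` is the image of `ℓ_j (G ∩ W)` under a map Lipschitz with a fixed constant `C`.

Proof (`hausdorffMeasure_lt_top_of_lipschitz_sections`): a countable subcover, disjoint Borel
pieces `S_i` with `𝓗^{2p}(S_i) ≤ C^{2p} 𝓗^{2p}(ℓ_{j_i} S_i)`, images Borel by the Lusin–Souslin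
theorem, and for each `j` the counting inequality
`Σ_{j_i = j} 𝓗^{2p}(ℓ_j S_i) ≤ Kb_j 𝓗^{2p}(ℓ_j G)`
(`Literature.Geometry.GeometricMeasureTheory.tsum_measure_le_of_card_le`), the right-hand side
being finite since `ℓ_j G ⊆ ℂᵖ` is bounded. This is Federer's `𝓗^m(T) ≤ Σ_λ k_λ 𝓛^m(p_λ T)`
[Federer1969, 3.2.27, 3.4.8 (13)] in the form needed here.

## References

* E. M. Chirka, *Complex Analytic Sets*, Kluwer 1989, §14.1 [Chirka1989].
* H. Federer, *Geometric Measure Theory*, Springer 1969, 3.2.27, 3.4.8 (13) [Federer1969].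
-/

open scoped ENNReal NNReal Topology
open Set Filter Function MeasureTheory MeasureTheory.Measure
open Literature.Geometry.GeometricMeasureTheory

namespace Literature.Geometry.Kaehler

namespace SCV

variable {E : Type*} [NormedAddCommGroup E] [NormedSpace ℂ E] [FiniteDimensional ℂ E]
  [MeasurableSpace E] [BorelSpace E]

/-- **Finite Hausdorff measure from Lipschitz sections with bounded multiplicity.** Let `G` be a
bounded Borel subset of a finite-dimensional complex normed space, `ℓ_j : E → ℂᵖ` (`j < k`)
continuous linear maps such that every fibre of `ℓ_j` contains at most `Kb_j` points of `G`, and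
suppose every `x ∈ G` has an open neighbourhood `W` together with some `j`, a set `D ⊇ ℓ_j(W)`
and a map `s : ℂᵖ → E` which is `C`-Lipschitz on `D` with `s (ℓ_j z) = z` for `z ∈ G ∩ W`. Then
`𝓗^{2p}(G) < ∞`. [cite: Federer1969, 3.2.27] -/
theorem hausdorffMeasure_lt_top_of_lipschitz_sections {p k : ℕ} {G : Set E}
    (hGm : MeasurableSet G) (hGb : Bornology.IsBounded G) (ℓ : Fin k → E →L[ℂ] (Fin p → ℂ))
    (C : ℝ≥0) (Kb : Fin k → ℕ)
    (hfib : ∀ j y, ∀ F : Finset E, (∀ x ∈ F, x ∈ G ∧ ℓ j x = y) → F.card ≤ Kb j)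
    (hloc : ∀ x ∈ G, ∃ (j : Fin k) (W : Set E) (D : Set (Fin p → ℂ)) (s : (Fin p → ℂ) → E),
      IsOpen W ∧ x ∈ W ∧ MapsTo (ℓ j) W D ∧ LipschitzOnWith C s D ∧
        ∀ z ∈ G ∩ W, s (ℓ j z) = z) :
    μH[2 * p] G < ∞ := by
  classical
  rcases G.eq_empty_or_nonempty with hGe | hGne
  · rw [hGe, measure_empty]; exact ENNReal.zero_lt_top
  haveI : ProperSpace E := FiniteDimensional.proper_rclike ℂ E
  haveI : CompleteSpace E := FiniteDimensional.complete ℂ E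
  haveI : PolishSpace E := inferInstance
  haveI : Nonempty G := hGne.to_subtype
  -- the local data, indexed by the points of `G`
  choose jf W D s hWo hxW hmaps hlip hsec using fun x : G => hloc x x.2
  -- a countable subcover `W (f i)`, `i : ℕ`
  obtain ⟨T, hTc, hTU⟩ := TopologicalSpace.isOpen_iUnion_countable (fun x : G => W x) hWo
  obtain ⟨f, hf⟩ : ∃ f : ℕ → G, T ⊆ range f := Set.countable_iff_exists_subset_range.1 hTc
  have hcov : G ⊆ ⋃ i : ℕ, W (f i) := by
    intro y hy
    have h1 : y ∈ ⋃ x : G, W x := mem_iUnion.2 ⟨⟨y, hy⟩, hxW ⟨y, hy⟩⟩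
    rw [← hTU] at h1
    obtain ⟨x, hxT, hyx⟩ := mem_iUnion₂.1 h1
    obtain ⟨i, rfl⟩ := hf hxT
    exact mem_iUnion.2 ⟨i, hyx⟩
  -- disjoint Borel pieces
  set Q : ℕ → Set E := fun i => G ∩ W (f i) with hQ
  set S : ℕ → Set E := disjointed Q with hS
  have hSm : ∀ i, MeasurableSet (S i) :=
    MeasurableSet.disjointed fun i => hGm.inter (hWo (f i)).measurableSet
  have hSsub : ∀ i, S i ⊆ G ∩ W (f i) := fun i => disjointed_subset Q i
  have hSdisj : Pairwise (Disjoint on S) := disjoint_disjointed Q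
  have hSU : (⋃ i, S i) = G := by
    rw [hS, iUnion_disjointed]
    apply subset_antisymm
    · exact iUnion_subset fun i => inter_subset_left
    · intro y hy
      obtain ⟨i, hi⟩ := mem_iUnion.1 (hcov hy)
      exact mem_iUnion.2 ⟨i, hy, hi⟩
  -- the projections of the pieces
  set jj : ℕ → Fin k := fun i => jf (f i) with hjj
  set P : ℕ → Set (Fin p → ℂ) := fun i => ℓ (jj i) '' S i with hP
  have hsecS : ∀ i, ∀ z ∈ S i, s (f i) (ℓ (jj i) z) = z := fun i z hz => hsec (f i) z (hSsub i hz)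
  have hinj : ∀ i, InjOn (ℓ (jj i)) (S i) := fun i z hz z' hz' h => by
    rw [← hsecS i z hz, ← hsecS i z' hz', h]
  have hPm : ∀ i, MeasurableSet (P i) := fun i =>
    (hSm i).image_of_continuousOn_injOn (ℓ (jj i)).continuous.continuousOn (hinj i)
  -- the piecewise estimate
  have hd : (0 : ℝ) ≤ 2 * p := by positivity
  have hpiece : ∀ i, μH[2 * p] (S i) ≤ (C : ℝ≥0∞) ^ (2 * p : ℝ) * μH[2 * p] (P i) := by
    intro i
    have himg : s (f i) '' (P i) = S i := by
      apply subset_antisymm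
      · rintro _ ⟨_, ⟨z, hz, rfl⟩, rfl⟩
        rw [hsecS i z hz]; exact hz
      · intro z hz
        exact ⟨ℓ (jj i) z, ⟨z, hz, rfl⟩, hsecS i z hz⟩
    have hlipP : LipschitzOnWith C (s (f i)) (P i) :=
      (hlip (f i)).mono (by
        rintro _ ⟨z, hz, rfl⟩
        exact hmaps (f i) (hSsub i hz).2)
    calc μH[2 * p] (S i) = μH[2 * p] (s (f i) '' P i) := by rw [himg]
      _ ≤ (C : ℝ≥0∞) ^ (2 * p : ℝ) * μH[2 * p] (P i) := hlipP.hausdorffMeasure_image_le hd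
  -- the multiplicity of the projections of the pieces with a given `j`
  have hmult : ∀ j y, ∀ F : Finset {i // jj i = j}, (∀ i ∈ F, y ∈ P i) → F.card ≤ Kb j := by
    intro j y F hF
    have hex : ∀ i : {i // jj i = j}, i ∈ F → ∃ x ∈ S (i : ℕ), ℓ j x = y := by
      intro i hi
      obtain ⟨x, hx, hxy⟩ := hF i hi
      refine ⟨x, hx, ?_⟩
      rw [← i.2]; exact hxy
    choose! xf hxS hxy using hex
    have hinjF : Set.InjOn xf (F : Set {i // jj i = j}) := by
      intro i hi i' hi' h
      by_contra hne
      have hne' : (i : ℕ) ≠ i' := fun h' => hne (Subtype.ext h')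
      have hdis := hSdisj hne'
      exact Set.disjoint_left.1 hdis (hxS i hi) (h ▸ hxS i' hi')
    calc F.card = (F.image xf).card := (Finset.card_image_of_injOn hinjF).symm
      _ ≤ Kb j := hfib j y _ fun x hx => by
          obtain ⟨i, hi, rfl⟩ := Finset.mem_image.1 hx
          exact ⟨(hSsub i (hxS i hi)).1, hxy i hi⟩
  -- the counting inequality for each `j`
  have hcount : ∀ j, ∑' i : {i // jj i = j}, μH[2 * p] (P i) ≤
      Kb j * μH[2 * p] (ℓ j '' G) := by
    intro j
    refine tsum_measure_le_of_card_le (P := fun i : {i // jj i = j} => P i) (fun i => hPm i)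
      (fun i => ?_) (hmult j)
    rintro _ ⟨z, hz, rfl⟩
    rw [i.2]
    exact ⟨z, (hSsub i hz).1, rfl⟩
  -- finiteness of the right-hand sides
  have hfin : ∀ j, μH[2 * p] (ℓ j '' G) < ∞ := by
    intro j
    have h := hausdorffMeasure_two_mul_lt_top_of_isBounded (W := Fin p → ℂ)
      ((ℓ j).lipschitz.isBounded_image hGb)
    simpa using h
  -- assembling
  calc μH[2 * p] G = μH[2 * p] (⋃ i, S i) := by rw [hSU]
    _ ≤ ∑' i, μH[2 * p] (S i) := measure_iUnion_le _
    _ ≤ ∑' i, (C : ℝ≥0∞) ^ (2 * p : ℝ) * μH[2 * p] (P i) := ENNReal.tsum_le_tsum hpiece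
    _ = (C : ℝ≥0∞) ^ (2 * p : ℝ) * ∑' i, μH[2 * p] (P i) := ENNReal.tsum_mul_left
    _ = (C : ℝ≥0∞) ^ (2 * p : ℝ) *
          ∑' q : Σ j, {i // jj i = j}, μH[2 * p] (P q.2) := by
        rw [← (Equiv.sigmaFiberEquiv jj).tsum_eq]; rfl
    _ = (C : ℝ≥0∞) ^ (2 * p : ℝ) *
          ∑' j, ∑' i : {i // jj i = j}, μH[2 * p] (P i) := by
        rw [ENNReal.tsum_sigma']
    _ ≤ (C : ℝ≥0∞) ^ (2 * p : ℝ) * ∑' j, (Kb j * μH[2 * p] (ℓ j '' G)) := by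
        gcongr with j
        exact hcount j
    _ < ∞ := by
        refine ENNReal.mul_lt_top (ENNReal.rpow_lt_top_of_nonneg hd ENNReal.coe_ne_top) ?_
        rw [tsum_fintype]
        exact ENNReal.sum_lt_top.2 fun j _ => ENNReal.mul_lt_top (ENNReal.natCast_lt_top _) (hfin j)

end SCV

end Literature.Geometry.Kaehler
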